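import Summits.QuantumFields.BalabanUV.Beta.EriceFlowEnclosureB12AsPrintedHistoryContagionShift
import Summits.QuantumFields.BalabanUV.Beta.EriceFlowEnclosureB12AsPrintedHistoryContagionEnd
import Literature.MathematicalPhysics.QuantumFieldTheory.Balaban1983to89.T4BetaFlowWellPosed

/-!
# Beta / EriceFlowEnclosureB12AsPrintedHistoryContagionShiftEnd — ASYMPTOTIC FREEDOM IS CONTAGIOUS, part 6 (ENDs on the as-printed carrier):
# [I] THEOREM 2 AS TYPED at ONE renormalized coupling supplies the reference family of part 5, so — given NE4 and coupling-chart fading memory on a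
# box of ANY size — (i) EVERY family of rows of the coupling table pinned at a renormalized coupling g below ONE threshold has node U2's
# `InjectedRate` and a CONTINUUM RUNNING COUPLING at every physical scale (convergence as the cutoff ε = L^{−K} → 0, limit flow, geometric tail,
# the printed two-sided logarithmic running (0.31) IN THE CONTINUUM up to an end-anchored defect); (ii) Theorem 2's OWN tuned rows «g₀ = g₀(ε, g)»
# form such a family at every small g — THE CONTINUUM LIMIT OF THEOREM 2's RUNNING COUPLING EXISTS, scale by scale; (iii) with the printed
# `Definitions` it is WELL DEFINED (any two pinned row families at the same small g coincide row by row, part 3).  NO asymptotic-freedom letter on β,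
# NO sign, NO (U), NO box-versus-modulus admission (β-flow team, prover 1 = recursion ∕ upper ∕ bare-coupling ∕ uniqueness side, unit
# `b2b-balaban-beta-bflow-p1`, gen 36; ROW AP-I·Uc × NODE U2; part 5 `…HistoryContagionShift` = the kernel; parts 1–4 gen 35)

HONEST FRAMING (page 1 of everything the β sub-cell writes): discharging `BetaPertH` makes Bałaban's UV stability UNCONDITIONAL — a
real constructive-QFT result; it is NOT the continuum limit and NOT the Clay problem.  HONEST DEPENDENCY (cell reorg 2026-08-19,
verbatim): «continuum YM on T⁴ ⇐ BetaPertH ∧ nine spine estimates (0/9 proved); BetaPertH ⇐ (D1) ∧ (D4) ∧ CAP+tail; G-an2-4 gates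
asym, D1 and NE2/3/4.»  THIS MODULE DISCHARGES NOTHING: junctions BY NAME over the NAMED FIELDS of the statement-exact typing
`B12BetaAsPrinted` of [I] = T. Bałaban, Commun. Math. Phys. **109** (1987) [Balaban1987RG1] — `Theorem2Statement S hL` ([I] Theorem 2 AS TYPED,
`Missing.B12Thm2Shape`: the constants β, β′ of (0.31) chosen AFTER the renormalized coupling g; Theorem 2 is STATED WITHOUT PROOF in print, p. 259,
[Balaban1989LargeFieldII] p. 355 — a HYPOTHESIS here), the printed `Definitions` ((0.18): a row starts at its bare coupling), the binder `hrg` ((0.20)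
along in-box rows) — with part 5's kernel (node U2's `disc_le_of_fadingMemory` ∕ `T4ContinuumCoupling` BY NAME) and part 3's
`theorem2_unique_bigBox_typed`.  The LETTERS `ScaleShiftRate c θ γ` (NE4; NOT PRINTED, GAPS G-t4-U2-1), `HistLipschitz Λ γ` ∕ `FadingMemory C θ Λ`
(NOT PRINTED, GAPS G-t4-U2-2; p. 298 says only that β_j depends on the preceding couplings) are HYPOTHESES on the abstract family `S.β`; NOTHING is
asserted about Bałaban's β.  «Continuum running coupling» means the limit of the EFFECTIVE COUPLINGS g_k of (0.20) at fixed physical scale as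
K → ∞ (`T4ContinuumCoupling.gstar`) — NOT the continuum limit of the measures, NOT a statement about the nine spine estimates.

THE POINT.  Node U2's booking of the continuum running coupling (`T4ContinuumCoupling.continuumRunning_of_runs_eventual`) lists, besides NE4 and the
moduli, the asymptotic-freedom letter `EventualLowerH b γ k₀ β` (T09.F — the β-function paper «has not been published yet») and the admission
`C((k₀+1)γ³ + 2γ∕b) ≤ (1 − θ)∕2` tying the box to the modulus.  On the as-printed carrier both are replaced by what IS printed (though unproved):
Theorem 2, read AS TYPED, at ONE renormalized coupling g₁ — §5 turns it into part 5's pinned reference family (rows in ]0, min(γ₀, γ_u)], endpoint g₁,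
(0.31) both halves at rates β(g₁) ln L ≤ β′(g₁) ln L, (0.20) along them by `hrg`); §6 reads off part 5: ONE threshold g₂ > 0 below which EVERY
pinned family of rows — any depths' torus exponents, any bare couplings, anywhere in the box ]0, γ_u] of ANY size against (C, θ) — has
`InjectedRate (2c∕(1 − θ)) 0 θ` and the continuum running coupling with `(1∕(4g²) + (β ln L∕4)m) ≤ 1∕gstar² ≤ 7∕(4g²) + ((β′ + 3β∕4) ln L)m`
(`continuumCoupling_bigBox_of_typedTheorem2`); §7: Theorem 2's own rows at every g ≤ g₃ ARE such a family (`continuumCoupling_of_typedTheorem2` —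
existence of the continuum limit of «g₀(ε, g)»'s effective couplings), and under `Definitions` two pinned row families at the same small g
coincide row by row, so the continuum running coupling is a FUNCTION of (m, g) (`continuumCoupling_wellDefined_of_typedTheorem2`).

WHAT THIS FILE PROVES (0 sorry, 0 def):
§5 `referenceFamily_of_typedTheorem2`.
§6 **`continuumCoupling_bigBox_of_typedTheorem2`**, **`memFlow_bigBox_of_typedTheorem2`** (node U2's `T4BetaFlowWellPosed.memFlow_gstar` BY NAME: the continuum
   running coupling SOLVES (0.20) IN THE CONTINUUM with the STATIONARY limit functional `betaInf S.β` of `T4BetaStationary` — the flow with memory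
   `1∕gstar(m+1)² = 1∕gstar(m)² + betaInf S.β (gstar(m+1), gstar(m+2), …)`, `gstar 0 = g_IR`; floor-free).
§7 **`continuumCoupling_of_typedTheorem2`**, **`continuumCoupling_wellDefined_of_typedTheorem2`**.
NOT CLAIMED: any letter for Bałaban's β; `ContinuumRunning.lower` (a pointwise floor on the continuum β-values — part 3's end defect is genuine);
Theorem 2 itself; `BetaPertH`; the continuum limit of the measures; Clay.
-/

namespace Summit.QuantumFields.BalabanUV.Beta.EriceFlowEnclosureB12AsPrintedHistoryContagionShiftEnd

open Finset Filter Topology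
open Literature.MathematicalPhysics.QuantumFieldTheory.Balaban1983to89
open Literature.MathematicalPhysics.QuantumFieldTheory.Balaban1983to89.B12BetaAsPrinted
open Literature.MathematicalPhysics.QuantumFieldTheory.Balaban1983to89.FlowStep (prefixOf Box mem_box RGEqH)
open Literature.MathematicalPhysics.QuantumFieldTheory.Balaban1983to89.T4CouplingMatching (HistLipschitz FadingMemory ScaleShiftRate prof sprof
  disc)
open Literature.MathematicalPhysics.QuantumFieldTheory.Balaban1983to89.T4CauchySum (InjectedRate)
open Literature.MathematicalPhysics.QuantumFieldTheory.Balaban1983to89.T4ContinuumCoupling (invSq astar gstar bstar)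
open Literature.MathematicalPhysics.QuantumFieldTheory.Balaban1983to89.T4BetaStationary (SeqBox betaInf)
open Literature.MathematicalPhysics.QuantumFieldTheory.Balaban1983to89.T4BetaFlowWellPosed (MemFlow seqBox_gstar memFlow_gstar)
open Summit.QuantumFields.BalabanUV.Beta.EriceFlowEnclosureB12AsPrintedUpper (tunedRuns_of_theorem2Statement)
open Summit.QuantumFields.BalabanUV.Beta.EriceFlowEnclosureB12AsPrintedHistoryContagionProfile (threshold_exists)
open Summit.QuantumFields.BalabanUV.Beta.EriceFlowEnclosureB12AsPrintedHistoryContagionEnd (theorem2_unique_bigBox_typed)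
open Summit.QuantumFields.BalabanUV.Beta.EriceFlowEnclosureB12AsPrintedHistoryContagionShift (injectedRate_of_reference
  continuumCoupling_of_reference quarterProf_le_astar astar_le_of_reference_upper)

noncomputable section

variable {S : Setting}

/-! ## §5 Theorem 2 AS TYPED at one renormalized coupling = a pinned reference family -/

/-- **THE REFERENCE FAMILY FROM THEOREM 2 AS TYPED.**  `Theorem2Statement S hL` (typed: ∀ m ∃ γ₀ ∀ γ ≤ γ₀ ∃ g₁ ∀ g ≤ g₁ ∃ β ≤ β′ ∀ K ∃ g₀ …) and the binder
`hrg` on a box ]0, γ_u] give, for every torus exponent m: bare couplings `g₀ K` (one per depth), ONE endpoint g* > 0 and rates 0 < β* ≤ β′* such that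
every row (K, m, g₀ K) obeys (0.20), lies in ]0, γ_u], ends at g*, and carries the per-step (0.31) `1∕g*² + β*(K − i) ≤ 1∕g_i² ≤ 1∕g*² + β′*(K − i)` —
part 5's pinned reference family (γ := min(γ₀, γ_u), g* := g₁, β* = β(g₁) ln L). [cite: Balaban1987RG1, Thm 2 (0.31) p.259] -/
theorem referenceFamily_of_typedTheorem2 {hL : Odd S.L ∧ 1 < S.L} (h : Theorem2Statement S hL) {γu : ℝ} (hγu : 0 < γu)
    (hrg : ∀ P : B12.RunParams, Step.InInterval γu P.K (S.cpl P) → RGEqH P.K S.β (S.cpl P)) (m : ℕ) :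
    ∃ (g₀ : ℕ → ℝ) (gs bs bs' : ℝ), 0 < gs ∧ 0 < bs ∧ bs ≤ bs' ∧
      (∀ K, RGEqH K S.β (S.cpl ⟨K, m, g₀ K⟩)) ∧ (∀ K i, i ≤ K → 0 < S.cpl ⟨K, m, g₀ K⟩ i ∧ S.cpl ⟨K, m, g₀ K⟩ i ≤ γu) ∧
      (∀ K, S.cpl ⟨K, m, g₀ K⟩ K = gs) ∧
      (∀ (K i : ℕ), i ≤ K → 1 / gs ^ 2 + bs * ((K : ℝ) - i) ≤ 1 / (S.cpl ⟨K, m, g₀ K⟩ i) ^ 2) ∧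
      (∀ (K i : ℕ), i ≤ K → 1 / (S.cpl ⟨K, m, g₀ K⟩ i) ^ 2 ≤ 1 / gs ^ 2 + bs' * ((K : ℝ) - i)) := by
  obtain ⟨γ₀, hγ₀, hγ⟩ := tunedRuns_of_theorem2Statement h m
  obtain ⟨g₁, hg₁, hg⟩ := hγ (min γ₀ γu) (lt_min hγ₀ hγu) (min_le_left _ _)
  obtain ⟨β, β', hβ, hββ', hT⟩ := hg g₁ hg₁ le_rfl
  choose g₀ hI hend h031 using hT
  have hlog : 0 < Real.log S.L := Real.log_pos (by exact_mod_cast hL.2)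
  have hbox : ∀ K i, i ≤ K → 0 < S.cpl ⟨K, m, g₀ K⟩ i ∧ S.cpl ⟨K, m, g₀ K⟩ i ≤ γu := fun K i hi =>
    ⟨(hI K i hi).1, (hI K i hi).2.trans (min_le_right _ _)⟩
  refine ⟨g₀, g₁, β * Real.log S.L, β' * Real.log S.L, hg₁, mul_pos hβ hlog, mul_le_mul_of_nonneg_right hββ' hlog.le,
    fun K => hrg ⟨K, m, g₀ K⟩ (hbox K), hbox, hend, fun K i hi => (h031 K i hi).1, fun K i hi => (h031 K i hi).2⟩

/-! ## §6 Every pinned row family below one threshold: node U2's `InjectedRate` and the continuum running coupling -/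

/-- **THE CONTINUUM RUNNING COUPLING OF EVERY PINNED ROW FAMILY, FROM THEOREM 2 AS TYPED.**  `Theorem2Statement S hL` (a HYPOTHESIS), the binder `hrg` on
]0, γ_u], NE4 `ScaleShiftRate c θ γ_u S.β` (c ≥ 0), `HistLipschitz Λ γ_u S.β` with `FadingMemory C θ Λ` (0 < θ < 1, C ≥ 0) ⟹ for every m there are g₂ > 0
and rates 0 < b ≤ b′ such that EVERY family `K ↦ g K` of ROWS of the coupling table (depth K, any torus exponent, any bare coupling) lying in ]0, γ_u]
and pinned `g K K = g_IR ≤ g₂` has: node U2's `InjectedRate (2c∕(1 − θ)) 0 θ` for its consecutive-cutoff discrepancies; the effective couplings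
converging at every physical scale, `g (n+m′) n → gstar g m′ ∈ ]0, γ_u]`, `gstar g 0 = g_IR`; the limit flow; the diagonal β-limits; the geometric tail
`(2c∕(1 − θ))θ^n∕(1 − θ)`; and IN THE CONTINUUM the printed two-sided logarithmic running with an end-anchored defect,
`1∕(4g_IR²) + b·m′ ≤ astar g m′ = 1∕(gstar g m′)² ≤ 7∕(4g_IR²) + b′·m′`, `gstar g m′ ≤ (1∕(4g_IR²) + b·m′)^{−1∕2}`.  The box γ_u is ARBITRARY against
(C, θ); NO asymptotic-freedom letter, NO sign, NO (U). [cite: Balaban1987RG1, Thm 2 (0.31) p.259, (0.20) p.256, §5 p.298] -/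
theorem continuumCoupling_bigBox_of_typedTheorem2 {hL : Odd S.L ∧ 1 < S.L} (h : Theorem2Statement S hL)
    {γu θ C c : ℝ} {Λ : ℕ → ℕ → ℝ} (hγu : 0 < γu)
    (hrg : ∀ P : B12.RunParams, Step.InInterval γu P.K (S.cpl P) → RGEqH P.K S.β (S.cpl P))
    (hS : ScaleShiftRate c θ γu S.β) (hL' : HistLipschitz Λ γu S.β) (hΛ : FadingMemory C θ Λ)
    (hθ0 : 0 < θ) (hθ1 : θ < 1) (hC : 0 ≤ C) (hc : 0 ≤ c) (m : ℕ) :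
    ∃ g₂ b b' : ℝ, 0 < g₂ ∧ 0 < b ∧ b ≤ b' ∧ ∀ (g : ℕ → ℕ → ℝ) (gIR : ℝ),
      (∀ K, ∃ (m' : ℕ) (g₀ : ℝ), g K = S.cpl ⟨K, m', g₀⟩) → (∀ K, Step.InInterval γu K (g K)) → (∀ K, g K K = gIR) → gIR ≤ g₂ →
      InjectedRate (2 * c / (1 - θ)) 0 θ (fun K j => disc (g K) (g (K + 1)) j) ∧
      (∀ m', Tendsto (fun n => g (n + m') n) atTop (𝓝 (gstar g m'))) ∧ (∀ m', 0 < gstar g m' ∧ gstar g m' ≤ γu) ∧ gstar g 0 = gIR ∧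
      (∀ m', 1 / (gstar g (m' + 1)) ^ 2 = 1 / (gstar g m') ^ 2 + bstar g m') ∧
      (∀ m', Tendsto (fun n => S.β n (prefixOf (g (n + m' + 1)) n)) atTop (𝓝 (bstar g m'))) ∧
      (∀ m' n, |1 / (g (n + m') n) ^ 2 - 1 / (gstar g m') ^ 2| ≤ 2 * c / (1 - θ) * θ ^ n / (1 - θ)) ∧
      (∀ m' : ℕ, 1 / (4 * gIR ^ 2) + b * (m' : ℝ) ≤ astar g m' ∧ astar g m' ≤ 7 / (4 * gIR ^ 2) + b' * (m' : ℝ)) ∧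
      (∀ m', gstar g m' ≤ 1 / sprof (2 * gIR) b m') := by
  obtain ⟨g₀, gs, bs, bs', hgs, hbs, hbb', hrunt, hboxt, hpint, h031, h031'⟩ := referenceFamily_of_typedTheorem2 h hγu hrg m
  obtain ⟨e₀, he₀, hthr⟩ := threshold_exists (γ := γu) gs hθ1 hC hbs
  refine ⟨e₀, bs / 4, bs' + 3 * bs / 4, he₀, by positivity, by linarith, fun g gIR hrow hI hpin hle => ?_⟩
  have hbox : ∀ K i, i ≤ K → 0 < g K i ∧ g K i ≤ γu := fun K => hI K
  have hrun : ∀ K, RGEqH K S.β (g K) := fun K => by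
    obtain ⟨m', g₀', hK⟩ := hrow K
    rw [hK]
    exact hrg ⟨K, m', g₀'⟩ (by rw [← hK]; exact hI K)
  have hgIR : 0 < gIR := by rw [← hpin 0]; exact (hbox 0 0 le_rfl).1
  obtain ⟨hs1, hs2, hs3⟩ := hthr gIR hgIR hle
  have hinj := injectedRate_of_reference g _ hθ0 hθ1 hC hc hbs hS hL' hΛ hrun hbox hpin hrunt hboxt hpint h031 hs1 hs2 hs3
  obtain ⟨h1, h2, h3, h4, h5, h6, h7⟩ :=
    continuumCoupling_of_reference g _ hθ0 hθ1 hC hc hbs hS hL' hΛ hrun hbox hpin hrunt hboxt hpint h031 hs1 hs2 hs3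
  refine ⟨hinj, h1, h2, h3, h4, h5, h6, fun m' => ⟨?_, ?_⟩, h7⟩
  · exact quarterProf_le_astar hθ1 hinj hθ0.le hθ1 hC hbs hL' hΛ hrun hbox hpin hrunt hboxt hpint h031 hs1 hs2 m'
  · exact astar_le_of_reference_upper hθ1 hinj hθ0.le hθ1 hC hbs hL' hΛ hrun hbox hpin hrunt hboxt hpint h031 h031' hs1 hs2 m'

/-- **… AND IT SOLVES THE RENORMALIZATION GROUP EQUATION OF THE LIMIT: (0.20) IN THE CONTINUUM WITH THE STATIONARY β-FUNCTIONAL.**  Under the data of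
`continuumCoupling_bigBox_of_typedTheorem2`, below the same kind of threshold every pinned row family's continuum running coupling `gstar g` is box-valued and
satisfies node U2's flow with memory `MemFlow (betaInf S.β) g_IR (gstar g)`: `gstar g 0 = g_IR` and `1∕(gstar g (m′+1))² = 1∕(gstar g m′)² + betaInf S.β (j ↦ gstar g (m′+1+j))`
for every m′, where `betaInf S.β h = lim_k β_k(h_k, …, h_0)` is the STATIONARY limit functional of `T4BetaStationary` (it exists under NE4) — node U2's
`T4BetaFlowWellPosed.memFlow_gstar` BY NAME on §6's floor-free `InjectedRate`.  (Node U2's INTRINSIC UNIQUENESS `eq_gstar_of_memFlow` keeps its floor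
`EventualLowerH b` and `C_m·γ < b(1 − θ)`; not claimed here.) [cite: Balaban1987RG1, (0.20) p.256, Thm 2 (0.31) p.259, §5 p.298] -/
theorem memFlow_bigBox_of_typedTheorem2 {hL : Odd S.L ∧ 1 < S.L} (h : Theorem2Statement S hL)
    {γu θ C c : ℝ} {Λ : ℕ → ℕ → ℝ} (hγu : 0 < γu)
    (hrg : ∀ P : B12.RunParams, Step.InInterval γu P.K (S.cpl P) → RGEqH P.K S.β (S.cpl P))
    (hS : ScaleShiftRate c θ γu S.β) (hL' : HistLipschitz Λ γu S.β) (hΛ : FadingMemory C θ Λ)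
    (hθ0 : 0 < θ) (hθ1 : θ < 1) (hC : 0 ≤ C) (hc : 0 ≤ c) (m : ℕ) :
    ∃ g₂ : ℝ, 0 < g₂ ∧ ∀ (g : ℕ → ℕ → ℝ) (gIR : ℝ),
      (∀ K, ∃ (m' : ℕ) (g₀ : ℝ), g K = S.cpl ⟨K, m', g₀⟩) → (∀ K, Step.InInterval γu K (g K)) → (∀ K, g K K = gIR) → gIR ≤ g₂ →
      InjectedRate (2 * c / (1 - θ)) 0 θ (fun K j => disc (g K) (g (K + 1)) j) ∧
      SeqBox γu (gstar g) ∧ MemFlow (betaInf S.β) gIR (gstar g) := by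
  obtain ⟨g₂, b, b', hg₂, -, -, hall⟩ := continuumCoupling_bigBox_of_typedTheorem2 h hγu hrg hS hL' hΛ hθ0 hθ1 hC hc m
  refine ⟨g₂, hg₂, fun g gIR hrow hI hpin hle => ?_⟩
  obtain ⟨hinj, -⟩ := hall g gIR hrow hI hpin hle
  have hbox : ∀ K i, i ≤ K → 0 < g K i ∧ g K i ≤ γu := fun K => hI K
  have hrun : ∀ K, RGEqH K S.β (g K) := fun K => by
    obtain ⟨m', g₀', hK⟩ := hrow K
    rw [hK]
    exact hrg ⟨K, m', g₀'⟩ (by rw [← hK]; exact hI K)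
  exact ⟨hinj, seqBox_gstar hθ1 hinj hbox, memFlow_gstar hθ1 hinj hbox hrun hpin hS hL' hΛ hθ0.le hθ1⟩

/-! ## §7 Theorem 2's own rows: the continuum limit of «g₀(ε, g)»'s effective couplings exists and is well defined -/

/-- **THE CONTINUUM LIMIT OF THEOREM 2's RUNNING COUPLING EXISTS, SCALE BY SCALE.**  `Theorem2Statement S hL` (a HYPOTHESIS), `hrg` on ]0, γ_u], NE4, and the
moduli with fading memory (0 < θ < 1) ⟹ for every torus exponent m there are g₃ > 0 and rates 0 < b ≤ b′ such that for EVERY renormalized coupling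
g ∈ ]0, g₃] Theorem 2's tuned bare couplings «g₀ = g₀(ε, g)» (one per cutoff ε = L^{−K}) give rows (K, m, g₀ K) in ]0, γ_u] pinned at g whose effective
couplings CONVERGE at every physical scale as K → ∞, with node U2's `InjectedRate`, the limit flow, the geometric tail, and the two-sided logarithmic
running in the continuum (`1∕(4g²) + b·m′ ≤ 1∕(gstar m′)² ≤ 7∕(4g²) + b′·m′`). [cite: Balaban1987RG1, Thm 2 (0.31) p.259, (0.20) p.256, §5 p.298] -/
theorem continuumCoupling_of_typedTheorem2 {hL : Odd S.L ∧ 1 < S.L} (h : Theorem2Statement S hL)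
    {γu θ C c : ℝ} {Λ : ℕ → ℕ → ℝ} (hγu : 0 < γu)
    (hrg : ∀ P : B12.RunParams, Step.InInterval γu P.K (S.cpl P) → RGEqH P.K S.β (S.cpl P))
    (hS : ScaleShiftRate c θ γu S.β) (hL' : HistLipschitz Λ γu S.β) (hΛ : FadingMemory C θ Λ)
    (hθ0 : 0 < θ) (hθ1 : θ < 1) (hC : 0 ≤ C) (hc : 0 ≤ c) (m : ℕ) :
    ∃ g₃ b b' : ℝ, 0 < g₃ ∧ 0 < b ∧ b ≤ b' ∧ ∀ gIR : ℝ, 0 < gIR → gIR ≤ g₃ →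
      ∃ g₀ : ℕ → ℝ, (∀ K, Step.InInterval γu K (S.cpl ⟨K, m, g₀ K⟩)) ∧ (∀ K, S.cpl ⟨K, m, g₀ K⟩ K = gIR) ∧
      InjectedRate (2 * c / (1 - θ)) 0 θ (fun K j => disc (S.cpl ⟨K, m, g₀ K⟩) (S.cpl ⟨K + 1, m, g₀ (K + 1)⟩) j) ∧
      (∀ m', Tendsto (fun n => S.cpl ⟨n + m', m, g₀ (n + m')⟩ n) atTop (𝓝 (gstar (fun K => S.cpl ⟨K, m, g₀ K⟩) m'))) ∧
      (∀ m', 0 < gstar (fun K => S.cpl ⟨K, m, g₀ K⟩) m' ∧ gstar (fun K => S.cpl ⟨K, m, g₀ K⟩) m' ≤ γu) ∧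
      gstar (fun K => S.cpl ⟨K, m, g₀ K⟩) 0 = gIR ∧
      (∀ m', 1 / (gstar (fun K => S.cpl ⟨K, m, g₀ K⟩) (m' + 1)) ^ 2
        = 1 / (gstar (fun K => S.cpl ⟨K, m, g₀ K⟩) m') ^ 2 + bstar (fun K => S.cpl ⟨K, m, g₀ K⟩) m') ∧
      (∀ m' n, |1 / (S.cpl ⟨n + m', m, g₀ (n + m')⟩ n) ^ 2 - 1 / (gstar (fun K => S.cpl ⟨K, m, g₀ K⟩) m') ^ 2|
        ≤ 2 * c / (1 - θ) * θ ^ n / (1 - θ)) ∧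
      (∀ m' : ℕ, 1 / (4 * gIR ^ 2) + b * (m' : ℝ) ≤ astar (fun K => S.cpl ⟨K, m, g₀ K⟩) m' ∧
        astar (fun K => S.cpl ⟨K, m, g₀ K⟩) m' ≤ 7 / (4 * gIR ^ 2) + b' * (m' : ℝ)) := by
  obtain ⟨g₂, b, b', hg₂, hb, hbb', hall⟩ := continuumCoupling_bigBox_of_typedTheorem2 h hγu hrg hS hL' hΛ hθ0 hθ1 hC hc m
  -- Theorem 2's own rows: existence of a pinned row family at every small renormalized coupling
  obtain ⟨γ₀, hγ₀, hγ⟩ := tunedRuns_of_theorem2Statement h m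
  obtain ⟨g₁, hg₁, hg⟩ := hγ (min γ₀ γu) (lt_min hγ₀ hγu) (min_le_left _ _)
  refine ⟨min g₁ g₂, b, b', lt_min hg₁ hg₂, hb, hbb', fun gIR hgIR hle => ?_⟩
  obtain ⟨β, β', -, -, hT⟩ := hg gIR hgIR (hle.trans (min_le_left _ _))
  choose g₀ hI hend _h031 using hT
  have hI' : ∀ K, Step.InInterval γu K (S.cpl ⟨K, m, g₀ K⟩) := fun K i hi =>
    ⟨(hI K i hi).1, (hI K i hi).2.trans (min_le_right _ _)⟩
  obtain ⟨hinj, h1, h2, h3, h4, -, h6, h7, -⟩ := hall (fun K => S.cpl ⟨K, m, g₀ K⟩) gIR (fun K => ⟨m, g₀ K, rfl⟩) hI' hend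
    (hle.trans (min_le_right _ _))
  exact ⟨g₀, hI', hend, hinj, h1, h2, h3, h4, h6, h7⟩

/-- **… AND IT IS WELL DEFINED: a FUNCTION of (m, g).**  With the printed `Definitions` in addition ((0.18): a row starts at its bare coupling), for every m
there is g₄ > 0 such that ANY two families of rows (K, m, g₀ K), (K, m, g₀′ K) lying in ]0, γ_u] and pinned at the SAME renormalized coupling g ≤ g₄
have the same bare couplings, the same rows, and hence the SAME continuum running coupling at every physical scale — part 3's
`theorem2_unique_bigBox_typed` row by row.  So on the typed interface, under NE4 and fading memory, «g₀ = g₀(ε, g)» has ONE continuum limit of its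
effective couplings per (m, g), independent of which tuned family is taken. [cite: Balaban1987RG1, Thm 2 p.259 («g₀ = g₀(ε, g)»), (0.18) p.255] -/
theorem continuumCoupling_wellDefined_of_typedTheorem2 {hL : Odd S.L ∧ 1 < S.L} (h : Theorem2Statement S hL) (hD : Definitions S)
    {γu θ C : ℝ} {Λ : ℕ → ℕ → ℝ} (hγu : 0 < γu)
    (hrg : ∀ P : B12.RunParams, Step.InInterval γu P.K (S.cpl P) → RGEqH P.K S.β (S.cpl P))
    (hL' : HistLipschitz Λ γu S.β) (hΛ : FadingMemory C θ Λ) (hθ0 : 0 < θ) (hθ1 : θ < 1) (hC : 0 ≤ C) (m : ℕ) :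
    ∃ g₄ : ℝ, 0 < g₄ ∧ ∀ (g₀ g₀' : ℕ → ℝ) (gIR : ℝ),
      (∀ K, Step.InInterval γu K (S.cpl ⟨K, m, g₀ K⟩)) → (∀ K, Step.InInterval γu K (S.cpl ⟨K, m, g₀' K⟩)) →
      (∀ K, S.cpl ⟨K, m, g₀ K⟩ K = gIR) → (∀ K, S.cpl ⟨K, m, g₀' K⟩ K = gIR) → gIR ≤ g₄ →
      g₀ = g₀' ∧ (fun K => S.cpl ⟨K, m, g₀ K⟩) = (fun K => S.cpl ⟨K, m, g₀' K⟩) ∧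
      ∀ m', gstar (fun K => S.cpl ⟨K, m, g₀ K⟩) m' = gstar (fun K => S.cpl ⟨K, m, g₀' K⟩) m' := by
  obtain ⟨g₂, hg₂, huniq⟩ := theorem2_unique_bigBox_typed h hD hγu hrg hL' hΛ hθ0 hθ1 hC m
  refine ⟨g₂, hg₂, fun g₀ g₀' gIR hI hI' hend hend' hle => ?_⟩
  have heq : g₀ = g₀' := funext fun K =>
    huniq K (g₀ K) (g₀' K) (hI K) (hI' K) ((hend K).trans (hend' K).symm) ((hend K).le.trans hle)
  subst heq
  exact ⟨rfl, rfl, fun _ => rfl⟩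

end

end Summit.QuantumFields.BalabanUV.Beta.EriceFlowEnclosureB12AsPrintedHistoryContagionShiftEnd
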